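import Summits.QuantumFields.YangMills.Theorems.UnitScaleGibbsActionDerivativeSlotDerivatives
import Summits.QuantumFields.YangMills.Theorems.UnitScaleGibbsSchwingerDysonGaussianDominationMoments
import Literature.MathematicalPhysics.QuantumFieldTheory.Balaban1983to89.T3UnitScaleTilt
import Literature.MathematicalPhysics.QuantumLattice.TracePowerInequalities
import HarnessLib

/-!
# Gross's Gaussian domination for `SU(N)` lattice Yang–Mills on Bałaban's tori — THE HYPOTHESIS-FREE THEOREM: for every U-independent `𝔰𝔲(N)`-valued
# bond field `u`, `X_u = ∂_u A` is centred sub-Gaussian under `gibbsMeasure P β` (hence `gibbsK`) with proxy `K(u)∕β`, `K(u) = (Σ_p (Σ_{i<4} ‖u_{b_i(p)}‖_F)²)∕N`, EVERY `β > 0`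

Crux of record `UnitScaleTilt.HistoryTailL` (stmt-QuantumFields-19936), cell `ym3-torus` (YM ladder rung R3 = continuum SU(2) Yang–Mills on T³ — a RUNG, NOT the
Clay problem: not d = 4, not infinite volume, not a mass gap); width seat `ym3-torus-px17` gen 7.  Assembly of ✓∕⧗ `UnitScaleGibbsSchwingerDysonGaussianDomination(Moments)`
(Gross's argument, abstract gauge group, from the rows `A′_b`, `X′_b`, `|Σ_b X′_b| ≤ K`) with ✓∕⧗ `UnitScaleGibbsActionDerivativeSlotCalculus ∕ …SlotDerivatives` (the rows
for `X_u = actionDeriv ρ u`, `A′_b = oneBondDeriv`, `X′_b = oneBondDeriv₂`, `Σ_b X′_b = actionDeriv₂`), closed by the one estimate of this file: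
* §1 Frobenius letters (`‖X‖_F² = Re tr(XᴴX) = Re tr(XXᴴ)`, unitary conjugation inside a trace) and ★ `abs_re_trace_mul_le_of_unitary` —
  `|Re tr((V₁XW₁)(V₂YW₂))| ≤ ‖X‖_F‖Y‖_F` for unitary `V₁,W₁,V₂,W₂` (trace Cauchy–Schwarz ✓ `norm_trace_mul_le_sqrt_mul_sqrt`);
* §2 ★★ `abs_re_trace_word₂_le` — each of the sixteen double-insertion words is `±(V₁u_{b_i}W₁)(V₂u_{b_l}W₂)`, so `|Re tr(word₂ p i l)| ≤ ‖u_{b_i}‖_F‖u_{b_l}‖_F` for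
  unitary-valued `ρ`; ★★ `abs_actionDeriv₂_le : |actionDeriv₂ ρ u U| ≤ hessianBound u` — THE CRUDE, CONFIGURATION-FREE HESSIAN BOUND `|∂_u∂_u A| ≤ K(u)`;
* §3 ★★★ MATRIX MODEL (`ρ` continuous, unitary-valued, `reTr = Re tr ρ∕N`, flows `ρ(k b t) = exp(t u_b)`, `β > 0`): `integral_exp_mul_actionDeriv_le : ∫ e^{sX_u} dμ_β ≤
  e^{K(u)s²∕(2β)}` (every real `s`), `integral_actionDeriv_eq_zero`, `integral_actionDeriv_sq_le : ∫ X_u² dμ_β ≤ K(u)∕β`, the two tails `exp(−βr²∕(2K(u)))`;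
* §4 ★★★ `SU(N)` (`ρ = fundamentalRep`, `u_b` skew-Hermitian traceless; flows from ✓ `exists_oneParam_specialUnitaryGroup`): `su_integral_exp_mul_actionDeriv_le`,
  `su_integral_actionDeriv_sq_le`, `su_measureReal_actionDeriv_ge_le`, and ★★ `gibbsK_actionDeriv_subgaussian` on `T3UnitScaleTilt.gibbsK F ℰ γ K` (`β_K = (γε_K)⁻¹ > 0`).

WHAT THIS IS, HONESTLY.  L. Gross's Thm 2.2 [GrossCMP1983] (`U(1)`, any `β`, any volume — tree ✓ `U1TorusFluxGaussianDomination`, seat px8 g9) for a NON-ABELIAN compact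
matrix group, with the abelian rate `‖dc‖²` replaced by the CRUDE GLOBAL load `K(u) ≍ ‖u‖²` — the 1-FORM norm of the test field, NOT the 2-form norm `‖du‖²`: no
cancellation inside the covariant curl `(D_U u)_p` is used (the four transported `u_b` may align), and for the GAUGE-VARIANT observable `∂_u A` with a FIXED `u` this
global constant is essentially SHARP (the Gibbs law carries a Haar-uniform gauge orbit; ideator ym-r3-idea-2 g15).  In LINE 28's CONSTRUCTION C3 («tree-gauge dressing»,
`Cruxes/HistoryTailL/GrossTransferAnnex4.md`) it is the OFF-EVENT constant; the ON-EVENT bound (A) `sup_{U∈G}|∂_u∂_u A| ≤ (1+ε)‖du‖² + …` (★w2 g14 (A2)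
`PlaquetteHessianCovariantCurl` + (A3′)), the tree-conditional SD step, S_lin and the large-field input (E) are NOT here, and nothing of «ShallowFluxSecondMomentL»,
«BlockSecondMomentL», (Q), K1, `MeanDeviationL`, `HistoryTailL`, R3, d = 4, a continuum limit or a mass gap is proved; LINE 28 is an idea, not a registered line; the
Yang–Mills mass gap is NOT proved.  `--supports stmt-QuantumFields-19936 --as helper`.  0 `def`, 0 `sorry`.
References: L. Gross, CMP 92 (1983) 137–162, Thm 2.2 [GrossCMP1983]; S. Chatterjee, CMP 366 (2019) §8 [Chatterjee2019LargeN]; Boucheron–Lugosi–Massart (2013) §2.2–§2.3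
[BoucheronLugosiMassart2013]; T. Bałaban, CMP 102 (1985) 255–275, (1)–(3) p.256 (the measures `gibbsK`) [Balaban1985UV3].
-/

set_option autoImplicit false

noncomputable section

open MeasureTheory Filter Topology NormedSpace
open scoped Matrix Matrix.Norms.Frobenius BigOperators
open Literature.MathematicalPhysics.QuantumFieldTheory.Balaban1983to89
open Literature.MathematicalPhysics.QuantumFieldTheory.Balaban1983to89.T4GenFunBounds (gibbsMeasure isProbabilityMeasure_gibbsMeasure)
open Literature.MathematicalPhysics.QuantumLattice (fundamentalRep fundamentalRep_mem_unitaryGroup continuous_fundamentalRep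
  trace_conjTranspose_mul_self_re trace_mul_conjTranspose_self_re norm_trace_mul_le_sqrt_mul_sqrt)
open Summit.QuantumFields.YangMills.Theorems.EquipartitionPinsProbe.TangentSteinFiniteBeta (exists_abs_le_of_continuous)
open Summit.QuantumFields.YangMills.Theorems.UnitScaleGibbsOneBondSchwingerDysonMatrix (exists_oneParam_specialUnitaryGroup)
open Summit.QuantumFields.YangMills.Theorems.UnitScaleGibbsActionDerivativeSlotCalculus
open Summit.QuantumFields.YangMills.Theorems.UnitScaleGibbsSchwingerDysonGaussianDomination

namespace Summit.QuantumFields.YangMills.Theorems.UnitScaleGibbsActionDerivativeGaussianDomination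

/-! ## §1 Frobenius letters: the norm as a trace, conjugation by unitaries, the trace Cauchy–Schwarz bound -/

section Frobenius

variable {N : ℕ}

/-- `‖X‖_F² = Re tr(XᴴX)`. [folklore] -/
theorem frobenius_norm_sq_eq_re_trace (X : Matrix (Fin N) (Fin N) ℂ) : ‖X‖ ^ 2 = (Xᴴ * X).trace.re := by
  rw [trace_conjTranspose_mul_self_re, Matrix.frobenius_norm_def, ← Real.sqrt_eq_rpow,
    Real.sq_sqrt (Finset.sum_nonneg fun _ _ => Finset.sum_nonneg fun _ _ => by positivity)]
  simp

/-- `‖X‖_F = √(Re tr(XᴴX))`. [folklore] -/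
theorem frobenius_norm_eq_sqrt (X : Matrix (Fin N) (Fin N) ℂ) : ‖X‖ = Real.sqrt ((Xᴴ * X).trace.re) := by
  rw [← frobenius_norm_sq_eq_re_trace, Real.sqrt_sq (norm_nonneg _)]

/-- `‖X‖_F = √(Re tr(XXᴴ))`. [folklore] -/
theorem frobenius_norm_eq_sqrt' (X : Matrix (Fin N) (Fin N) ℂ) : ‖X‖ = Real.sqrt ((X * Xᴴ).trace.re) := by
  rw [trace_mul_conjTranspose_self_re, ← trace_conjTranspose_mul_self_re, frobenius_norm_eq_sqrt]

/-- A unitary matrix times its adjoint is `1`. [folklore] -/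
theorem mul_conjTranspose_of_mem_unitary {V : Matrix (Fin N) (Fin N) ℂ} (hV : V ∈ Matrix.unitaryGroup (Fin N) ℂ) : V * Vᴴ = 1 := by
  simpa only [Matrix.star_eq_conjTranspose] using Matrix.mem_unitaryGroup_iff.mp hV

/-- The adjoint of a unitary matrix times the matrix is `1`. [folklore] -/
theorem conjTranspose_mul_of_mem_unitary {V : Matrix (Fin N) (Fin N) ℂ} (hV : V ∈ Matrix.unitaryGroup (Fin N) ℂ) : Vᴴ * V = 1 := by
  simpa only [Matrix.star_eq_conjTranspose] using Matrix.mem_unitaryGroup_iff'.mp hV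

/-- `Re tr((VXW)(VXW)ᴴ) = Re tr(XXᴴ)` for unitary `V, W`. [folklore] -/
theorem re_trace_mul_conjTranspose_conj {V W : Matrix (Fin N) (Fin N) ℂ} (hV : V ∈ Matrix.unitaryGroup (Fin N) ℂ)
    (hW : W ∈ Matrix.unitaryGroup (Fin N) ℂ) (X : Matrix (Fin N) (Fin N) ℂ) :
    ((V * X * W) * (V * X * W)ᴴ).trace.re = (X * Xᴴ).trace.re := by
  have h1 : (V * X * W) * (V * X * W)ᴴ = V * (X * Xᴴ) * Vᴴ := by
    rw [Matrix.conjTranspose_mul, Matrix.conjTranspose_mul]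
    calc V * X * W * (Wᴴ * (Xᴴ * Vᴴ)) = V * X * (W * Wᴴ) * (Xᴴ * Vᴴ) := by noncomm_ring
      _ = V * (X * Xᴴ) * Vᴴ := by rw [mul_conjTranspose_of_mem_unitary hW]; noncomm_ring
  rw [h1, Matrix.trace_mul_cycle, conjTranspose_mul_of_mem_unitary hV, one_mul]

/-- `Re tr((VYW)ᴴ(VYW)) = Re tr(YᴴY)` for unitary `V, W`. [folklore] -/
theorem re_trace_conjTranspose_mul_conj {V W : Matrix (Fin N) (Fin N) ℂ} (hV : V ∈ Matrix.unitaryGroup (Fin N) ℂ)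
    (hW : W ∈ Matrix.unitaryGroup (Fin N) ℂ) (Y : Matrix (Fin N) (Fin N) ℂ) :
    ((V * Y * W)ᴴ * (V * Y * W)).trace.re = (Yᴴ * Y).trace.re := by
  have h1 : (V * Y * W)ᴴ * (V * Y * W) = Wᴴ * (Yᴴ * Y) * W := by
    rw [Matrix.conjTranspose_mul, Matrix.conjTranspose_mul]
    calc Wᴴ * (Yᴴ * Vᴴ) * (V * Y * W) = Wᴴ * Yᴴ * (Vᴴ * V) * Y * W := by noncomm_ring
      _ = Wᴴ * (Yᴴ * Y) * W := by rw [conjTranspose_mul_of_mem_unitary hV]; noncomm_ring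
  rw [h1, Matrix.trace_mul_cycle, mul_conjTranspose_of_mem_unitary hW, one_mul]

/-- ★ **THE TRACE BOUND FOR TWO INSERTIONS**: `|Re tr((V₁XW₁)(V₂YW₂))| ≤ ‖X‖_F·‖Y‖_F` for unitary `V₁, W₁, V₂, W₂` (trace Cauchy–Schwarz, unitary invariance
of the Frobenius norm). [folklore] -/
theorem abs_re_trace_mul_le_of_unitary {V₁ W₁ V₂ W₂ : Matrix (Fin N) (Fin N) ℂ} (hV₁ : V₁ ∈ Matrix.unitaryGroup (Fin N) ℂ)
    (hW₁ : W₁ ∈ Matrix.unitaryGroup (Fin N) ℂ) (hV₂ : V₂ ∈ Matrix.unitaryGroup (Fin N) ℂ) (hW₂ : W₂ ∈ Matrix.unitaryGroup (Fin N) ℂ)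
    (X Y : Matrix (Fin N) (Fin N) ℂ) :
    |((V₁ * X * W₁) * (V₂ * Y * W₂)).trace.re| ≤ ‖X‖ * ‖Y‖ := by
  calc |((V₁ * X * W₁) * (V₂ * Y * W₂)).trace.re| ≤ ‖((V₁ * X * W₁) * (V₂ * Y * W₂)).trace‖ := Complex.abs_re_le_norm _
    _ ≤ Real.sqrt (((V₁ * X * W₁) * (V₁ * X * W₁)ᴴ).trace.re) * Real.sqrt (((V₂ * Y * W₂)ᴴ * (V₂ * Y * W₂)).trace.re) :=
        norm_trace_mul_le_sqrt_mul_sqrt _ _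
    _ = ‖X‖ * ‖Y‖ := by
        rw [re_trace_mul_conjTranspose_conj hV₁ hW₁, re_trace_conjTranspose_mul_conj hV₂ hW₂, ← frobenius_norm_eq_sqrt',
          ← frobenius_norm_eq_sqrt]

/-- The same bound for the negated product. [folklore] -/
theorem abs_re_trace_neg_mul_le_of_unitary {V₁ W₁ V₂ W₂ : Matrix (Fin N) (Fin N) ℂ} (hV₁ : V₁ ∈ Matrix.unitaryGroup (Fin N) ℂ)
    (hW₁ : W₁ ∈ Matrix.unitaryGroup (Fin N) ℂ) (hV₂ : V₂ ∈ Matrix.unitaryGroup (Fin N) ℂ) (hW₂ : W₂ ∈ Matrix.unitaryGroup (Fin N) ℂ)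
    (X Y : Matrix (Fin N) (Fin N) ℂ) :
    |(-((V₁ * X * W₁) * (V₂ * Y * W₂))).trace.re| ≤ ‖X‖ * ‖Y‖ := by
  rw [Matrix.trace_neg, Complex.neg_re, abs_neg]
  exact abs_re_trace_mul_le_of_unitary hV₁ hW₁ hV₂ hW₂ X Y

end Frobenius

/-! ## §2 The sixteen double-insertion words and the crude Hessian bound -/

section HessianBound

variable {N : ℕ} {P : Params} {j : ℕ} {G : Type} [GaugeGroup G]
  {ρ : G →* Matrix (Fin N) (Fin N) ℂ} (hρu : ∀ g : G, ρ g ∈ Matrix.unitaryGroup (Fin N) ℂ) (u : PBond P j → Matrix (Fin N) (Fin N) ℂ)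

include hρu

/-- ★★ **EACH DOUBLE-INSERTION WORD IS TRACE-BOUNDED BY THE TWO INSERTED NORMS**: `|Re tr(word₂ p i l)| ≤ ‖u_{b_i(p)}‖_F · ‖u_{b_l(p)}‖_F` (sixteen cases; every word is
`±(V₁ u_{b_i} W₁)(V₂ u_{b_l} W₂)` with `V, W` products of the unitary link matrices `ρU_e`, `ρ(U_e⁻¹)`). [cite: GrossCMP1983, Thm 2.2 (proof); Creutz2022, Ch. 11] -/
theorem abs_re_trace_word₂_le (U : GaugeField P j G) (p : Plaq P j) (i l : Fin 4) :
    |(word₂ ρ u U p i l).trace.re| ≤ ‖u (slotBond p i)‖ * ‖u (slotBond p l)‖ := by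
  have ha := hρu (U ⟨p.src, p.μ⟩)
  have hb := hρu (U ⟨p.src.shift p.μ, p.ν⟩)
  have hc := hρu ((U ⟨p.src.shift p.ν, p.μ⟩)⁻¹)
  have hd := hρu ((U ⟨p.src, p.ν⟩)⁻¹)
  have h1 : (1 : Matrix (Fin N) (Fin N) ℂ) ∈ Matrix.unitaryGroup (Fin N) ℂ := Submonoid.one_mem _
  have hmul : ∀ {A B : Matrix (Fin N) (Fin N) ℂ}, A ∈ Matrix.unitaryGroup (Fin N) ℂ → B ∈ Matrix.unitaryGroup (Fin N) ℂ →
      A * B ∈ Matrix.unitaryGroup (Fin N) ℂ := fun hA hB => Submonoid.mul_mem _ hA hB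
  -- names for the four link matrices and the four generators
  set a := ρ (U ⟨p.src, p.μ⟩) with ha_def
  set b := ρ (U ⟨p.src.shift p.μ, p.ν⟩) with hb_def
  set c := ρ ((U ⟨p.src.shift p.ν, p.μ⟩)⁻¹) with hc_def
  set d := ρ ((U ⟨p.src, p.ν⟩)⁻¹) with hd_def
  set x0 := u ⟨p.src, p.μ⟩ with hx0
  set x1 := u ⟨p.src.shift p.μ, p.ν⟩ with hx1
  set x2 := u ⟨p.src.shift p.ν, p.μ⟩ with hx2
  set x3 := u ⟨p.src, p.ν⟩ with hx3
  fin_cases i <;> fin_cases l <;>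
    simp only [word₂, word, slot, slotIns, slotIns₂, slotBond, Function.update_self, Function.update_of_ne, ne_eq, Fin.isValue,
      Matrix.cons_val_zero, Matrix.cons_val_one, Matrix.cons_val, Fin.zero_eta, Fin.mk_one, Fin.reduceFinMk, Fin.reduceEq, if_true, if_false,
      not_false_eq_true, one_ne_zero, zero_ne_one]
  -- (0,0)
  · rw [show x0 * (x0 * a) * b * c * d = (1 * x0 * 1) * (1 * x0 * (a * b * c * d)) by noncomm_ring]
    exact abs_re_trace_mul_le_of_unitary h1 h1 h1 (hmul (hmul (hmul ha hb) hc) hd) x0 x0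
  -- (0,1)
  · rw [show x0 * a * (x1 * b) * c * d = (1 * x0 * a) * (1 * x1 * (b * c * d)) by noncomm_ring]
    exact abs_re_trace_mul_le_of_unitary h1 ha h1 (hmul (hmul hb hc) hd) x0 x1
  -- (0,2)
  · rw [show x0 * a * b * (c * -x2) * d = -((1 * x0 * (a * b * c)) * (1 * x2 * d)) by noncomm_ring]
    exact abs_re_trace_neg_mul_le_of_unitary h1 (hmul (hmul ha hb) hc) h1 hd x0 x2
  -- (0,3)
  · rw [show x0 * a * b * c * (d * -x3) = -((1 * x0 * (a * b * c * d)) * (1 * x3 * 1)) by noncomm_ring]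
    exact abs_re_trace_neg_mul_le_of_unitary h1 (hmul (hmul (hmul ha hb) hc) hd) h1 h1 x0 x3
  -- (1,0)
  · rw [show x0 * a * (x1 * b) * c * d = (1 * x0 * a) * (1 * x1 * (b * c * d)) by noncomm_ring, mul_comm ‖x1‖]
    exact abs_re_trace_mul_le_of_unitary h1 ha h1 (hmul (hmul hb hc) hd) x0 x1
  -- (1,1)
  · rw [show a * (x1 * (x1 * b)) * c * d = (a * x1 * 1) * (1 * x1 * (b * c * d)) by noncomm_ring]
    exact abs_re_trace_mul_le_of_unitary ha h1 h1 (hmul (hmul hb hc) hd) x1 x1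
  -- (1,2)
  · rw [show a * (x1 * b) * (c * -x2) * d = -((a * x1 * (b * c)) * (1 * x2 * d)) by noncomm_ring]
    exact abs_re_trace_neg_mul_le_of_unitary ha (hmul hb hc) h1 hd x1 x2
  -- (1,3)
  · rw [show a * (x1 * b) * c * (d * -x3) = -((a * x1 * (b * c * d)) * (1 * x3 * 1)) by noncomm_ring]
    exact abs_re_trace_neg_mul_le_of_unitary ha (hmul (hmul hb hc) hd) h1 h1 x1 x3
  -- (2,0)
  · rw [show x0 * a * b * (c * -x2) * d = -((1 * x0 * (a * b * c)) * (1 * x2 * d)) by noncomm_ring, mul_comm ‖x2‖]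
    exact abs_re_trace_neg_mul_le_of_unitary h1 (hmul (hmul ha hb) hc) h1 hd x0 x2
  -- (2,1)
  · rw [show a * (x1 * b) * (c * -x2) * d = -((a * x1 * (b * c)) * (1 * x2 * d)) by noncomm_ring, mul_comm ‖x2‖]
    exact abs_re_trace_neg_mul_le_of_unitary ha (hmul hb hc) h1 hd x1 x2
  -- (2,2)
  · rw [show a * b * (c * -x2 * -x2) * d = (a * b * c * x2 * 1) * (1 * x2 * d) by noncomm_ring]
    exact abs_re_trace_mul_le_of_unitary (hmul (hmul ha hb) hc) h1 h1 hd x2 x2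
  -- (2,3)
  · rw [show a * b * (c * -x2) * (d * -x3) = (a * b * c * x2 * 1) * (d * x3 * 1) by noncomm_ring]
    exact abs_re_trace_mul_le_of_unitary (hmul (hmul ha hb) hc) h1 hd h1 x2 x3
  -- (3,0)
  · rw [show x0 * a * b * c * (d * -x3) = -((1 * x0 * (a * b * c * d)) * (1 * x3 * 1)) by noncomm_ring, mul_comm ‖x3‖]
    exact abs_re_trace_neg_mul_le_of_unitary h1 (hmul (hmul (hmul ha hb) hc) hd) h1 h1 x0 x3
  -- (3,1)
  · rw [show a * (x1 * b) * c * (d * -x3) = -((a * x1 * (b * c * d)) * (1 * x3 * 1)) by noncomm_ring, mul_comm ‖x3‖]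
    exact abs_re_trace_neg_mul_le_of_unitary ha (hmul (hmul hb hc) hd) h1 h1 x1 x3
  -- (3,2)
  · rw [show a * b * (c * -x2) * (d * -x3) = (a * b * c * x2 * 1) * (d * x3 * 1) by noncomm_ring, mul_comm ‖x3‖]
    exact abs_re_trace_mul_le_of_unitary (hmul (hmul ha hb) hc) h1 hd h1 x2 x3
  -- (3,3)
  · rw [show a * b * c * (d * -x3 * -x3) = (a * b * c * d * x3 * 1) * (1 * x3 * 1) by noncomm_ring]
    exact abs_re_trace_mul_le_of_unitary (hmul (hmul (hmul ha hb) hc) hd) h1 h1 h1 x3 x3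

variable [DecidableEq (PBond P j)]

omit [DecidableEq (PBond P j)] in
/-- ★★ **THE CRUDE, CONFIGURATION-FREE HESSIAN BOUND** `|actionDeriv₂ ρ u U| ≤ hessianBound u = (Σ_p (Σ_{i<4} ‖u_{b_i(p)}‖_F)²) ∕ N` — every torus, every `U`, unitary-valued `ρ`.
(No cancellation inside the covariant curl is used; the sharp small-field form `(1+ε)‖D_U u‖²` is LINE 28's stub S_dom.) [cite: GrossCMP1983, Thm 2.2 (proof)] -/
theorem abs_actionDeriv₂_le (U : GaugeField P j G) : |actionDeriv₂ ρ u U| ≤ hessianBound u := by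
  unfold actionDeriv₂ hessianBound
  have hN : (0 : ℝ) ≤ (N : ℝ) := Nat.cast_nonneg N
  have hterm : ∀ p (i l : Fin 4), |(-((word₂ ρ u U p i l).trace.re / (N : ℝ)))| ≤ ‖u (slotBond p i)‖ * ‖u (slotBond p l)‖ / N := by
    intro p i l
    rw [abs_neg, abs_div, abs_of_nonneg hN]
    exact div_le_div_of_nonneg_right (abs_re_trace_word₂_le hρu u U p i l) hN
  calc |∑ p : Plaq P j, ∑ i : Fin 4, ∑ l : Fin 4, -((word₂ ρ u U p i l).trace.re / (N : ℝ))|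
      ≤ ∑ p : Plaq P j, |∑ i : Fin 4, ∑ l : Fin 4, -((word₂ ρ u U p i l).trace.re / (N : ℝ))| := Finset.abs_sum_le_sum_abs _ _
    _ ≤ ∑ p : Plaq P j, ∑ i : Fin 4, |∑ l : Fin 4, -((word₂ ρ u U p i l).trace.re / (N : ℝ))| :=
        Finset.sum_le_sum fun p _ => Finset.abs_sum_le_sum_abs _ _
    _ ≤ ∑ p : Plaq P j, ∑ i : Fin 4, ∑ l : Fin 4, |(-((word₂ ρ u U p i l).trace.re / (N : ℝ)))| :=
        Finset.sum_le_sum fun p _ => Finset.sum_le_sum fun i _ => Finset.abs_sum_le_sum_abs _ _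
    _ ≤ ∑ p : Plaq P j, ∑ i : Fin 4, ∑ l : Fin 4, ‖u (slotBond p i)‖ * ‖u (slotBond p l)‖ / N :=
        Finset.sum_le_sum fun p _ => Finset.sum_le_sum fun i _ => Finset.sum_le_sum fun l _ => hterm p i l
    _ = (∑ p : Plaq P j, (∑ i : Fin 4, ‖u (slotBond p i)‖) ^ 2) / N := by
        rw [Finset.sum_div]
        refine Finset.sum_congr rfl fun p _ => ?_
        rw [sq, Finset.sum_mul_sum, Finset.sum_div]
        refine Finset.sum_congr rfl fun i _ => ?_
        rw [Finset.sum_div]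

omit hρu [GaugeGroup G] [DecidableEq (PBond P j)] in
/-- `0 ≤ hessianBound u`. [folklore] -/
theorem hessianBound_nonneg : 0 ≤ hessianBound (N := N) u := by
  unfold hessianBound
  exact div_nonneg (Finset.sum_nonneg fun _ _ => sq_nonneg _) (Nat.cast_nonneg N)

end HessianBound

/-! ## §3 Gaussian domination of `X_u` in the matrix model -/

section MatrixModel

variable {N : ℕ} {P : Params} [DecidableEq (PBond P 0)] {G : Type} [GaugeGroup G]
  [TopologicalSpace G] [IsTopologicalGroup G] [CompactSpace G] [MeasurableSpace G] [BorelSpace G] [SecondCountableTopology G]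
  [RegularGaugeGroup G] [HaarData G]
  {ρ : G →* Matrix (Fin N) (Fin N) ℂ} (hρ : Continuous ρ) (hre : ∀ g : G, reTr g = (ρ g).trace.re / N)
  (hρu : ∀ g : G, ρ g ∈ Matrix.unitaryGroup (Fin N) ℂ)
  (u : PBond P 0 → Matrix (Fin N) (Fin N) ℂ) {k : PBond P 0 → ℝ → G}
  (hk : ∀ b s t, k b (s + t) = k b s * k b t) (hkX : ∀ b t, ρ (k b t) = exp ((t : ℂ) • u b))

include hρ hre hρu hk hkX

omit [RegularGaugeGroup G] [HaarData G] in
/-- ★★ **THE ROWS OF THE ABSTRACT THEOREM ARE MET BY `X_u`** (matrix model): measurability and boundedness of `A′_b`, `X′_b` (continuity on the compact configuration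
space), the derivative rows (slot calculus), `Σ_b A′_b = X_u`, and `|Σ_b X′_b| ≤ K(u)`. [cite: GrossCMP1983, Thm 2.2 (proof)] -/
theorem rows :
    (∀ b, Measurable (oneBondDeriv ρ u b)) ∧ (∀ b, ∃ C, ∀ U : GaugeField P 0 G, |oneBondDeriv ρ u b U| ≤ C) ∧
    (∀ b (U : GaugeField P 0 G), HasDerivAt (fun t => wilsonAction4 (Function.update U b (k b t * U b))) (oneBondDeriv ρ u b U) 0) ∧
    (∀ U : GaugeField P 0 G, actionDeriv ρ u U = ∑ b, oneBondDeriv ρ u b U) ∧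
    (∀ b, Measurable (oneBondDeriv₂ ρ u b)) ∧ (∀ b, ∃ C, ∀ U : GaugeField P 0 G, |oneBondDeriv₂ ρ u b U| ≤ C) ∧
    (∀ b (U : GaugeField P 0 G), HasDerivAt (fun t => actionDeriv ρ u (Function.update U b (k b t * U b))) (oneBondDeriv₂ ρ u b U) 0) ∧
    (∀ U : GaugeField P 0 G, |∑ b, oneBondDeriv₂ ρ u b U| ≤ hessianBound u) := by
  haveI : CompactSpace (GaugeField P 0 G) := inferInstanceAs (CompactSpace (PBond P 0 → G))
  haveI : OpensMeasurableSpace (GaugeField P 0 G) := inferInstanceAs (OpensMeasurableSpace (PBond P 0 → G))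
  refine ⟨fun b => (continuous_oneBondDeriv hρ u b).measurable, fun b => ?_, fun b U => hasDerivAt_wilsonAction4_oneBond hre hk hkX b U,
    fun U => (sum_oneBondDeriv U).symm, fun b => (continuous_oneBondDeriv₂ hρ u b).measurable, fun b => ?_,
    fun b U => hasDerivAt_actionDeriv_oneBond hk hkX b U, fun U => ?_⟩
  · obtain ⟨C, -, hC⟩ := exists_abs_le_of_continuous (continuous_oneBondDeriv hρ u b)
    exact ⟨C, hC⟩
  · obtain ⟨C, -, hC⟩ := exists_abs_le_of_continuous (continuous_oneBondDeriv₂ hρ u b)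
    exact ⟨C, hC⟩
  · rw [sum_oneBondDeriv₂]; exact abs_actionDeriv₂_le hρu u U

/-- ★★★ **GROSS'S GAUSSIAN DOMINATION FOR `X_u = ∂_u A`, MATRIX MODEL** (`β > 0`, every real `s`, every torus):
`∫ exp(s·X_u) dμ_β ≤ exp(K(u)·s²∕(2β))`, `K(u) = hessianBound u`. [cite: GrossCMP1983, Thm 2.2] -/
theorem integral_exp_mul_actionDeriv_le {β : ℝ} (hβ : 0 < β) (s : ℝ) :
    ∫ U, Real.exp (s * actionDeriv ρ u U) ∂gibbsMeasure P β ≤ Real.exp (hessianBound u * s ^ 2 / (2 * β)) := by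
  obtain ⟨h1, h2, h3, h4, h5, h6, h7, h8⟩ := rows hρ hre hρu u hk hkX
  exact integral_exp_mul_le hβ (fun b => b) k hk (oneBondDeriv ρ u) h1 h2 h3 (actionDeriv ρ u) h4 (oneBondDeriv₂ ρ u) h5 h6 h7 h8 s

/-- ★ **`X_u` IS CENTRED**: `∫ X_u dμ_β = 0` (`β > 0`). [cite: Chatterjee2019LargeN, §8] -/
theorem integral_actionDeriv_eq_zero {β : ℝ} (hβ : 0 < β) : ∫ U, actionDeriv ρ u U ∂gibbsMeasure P β = 0 := by
  obtain ⟨h1, h2, h3, h4, -, -, -, -⟩ := rows hρ hre hρu u hk hkX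
  exact integral_eq_zero hβ (fun b => b) k hk (oneBondDeriv ρ u) h1 h2 h3 (actionDeriv ρ u) h4

/-- ★★★ **THE VARIANCE OF `X_u` AT THE FREE SCALE**: `∫ X_u² dμ_β ≤ K(u)∕β` (`β > 0`, every torus). [cite: GrossCMP1983, Thm 2.2] -/
theorem integral_actionDeriv_sq_le {β : ℝ} (hβ : 0 < β) :
    ∫ U, actionDeriv ρ u U ^ 2 ∂gibbsMeasure P β ≤ hessianBound u / β := by
  obtain ⟨h1, h2, h3, h4, h5, h6, h7, h8⟩ := rows hρ hre hρu u hk hkX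
  exact integral_sq_le hβ (fun b => b) k hk (oneBondDeriv ρ u) h1 h2 h3 (actionDeriv ρ u) h4 (oneBondDeriv₂ ρ u) h5 h6 h7 h8

/-- ★★ **UPPER TAIL**: `μ_β{r ≤ X_u} ≤ exp(−β r²∕(2K(u)))` (`β > 0`, `K(u) > 0`, `r ≥ 0`). [cite: GrossCMP1983, Thm 2.2; BoucheronLugosiMassart2013, §2.2] -/
theorem measureReal_actionDeriv_ge_le {β : ℝ} (hβ : 0 < β) (hKpos : 0 < hessianBound u) {r : ℝ} (hr : 0 ≤ r) :
    (gibbsMeasure (G := G) P β).real {U | r ≤ actionDeriv ρ u U} ≤ Real.exp (-(β * r ^ 2 / (2 * hessianBound u))) := by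
  obtain ⟨h1, h2, h3, h4, h5, h6, h7, h8⟩ := rows hρ hre hρu u hk hkX
  exact measureReal_le_exp_neg hβ (fun b => b) k hk (oneBondDeriv ρ u) h1 h2 h3 (actionDeriv ρ u) h4 (oneBondDeriv₂ ρ u) h5 h6 h7 hKpos h8 hr

/-- ★★ **LOWER TAIL**: `μ_β{X_u ≤ −r} ≤ exp(−β r²∕(2K(u)))`. [cite: GrossCMP1983, Thm 2.2; BoucheronLugosiMassart2013, §2.2] -/
theorem measureReal_actionDeriv_le_neg_le {β : ℝ} (hβ : 0 < β) (hKpos : 0 < hessianBound u) {r : ℝ} (hr : 0 ≤ r) :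
    (gibbsMeasure (G := G) P β).real {U | actionDeriv ρ u U ≤ -r} ≤ Real.exp (-(β * r ^ 2 / (2 * hessianBound u))) := by
  obtain ⟨h1, h2, h3, h4, h5, h6, h7, h8⟩ := rows hρ hre hρu u hk hkX
  exact measureReal_le_neg_le_exp_neg hβ (fun b => b) k hk (oneBondDeriv ρ u) h1 h2 h3 (actionDeriv ρ u) h4 (oneBondDeriv₂ ρ u) h5 h6 h7
    hKpos h8 hr

end MatrixModel

/-! ## §4 The `SU(N)` instance and Bałaban's `gibbsK` -/

section SpecialUnitary

variable {N : ℕ} [NeZero N] {P : Params} [DecidableEq (PBond P 0)]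
  (u : PBond P 0 → Matrix (Fin N) (Fin N) ℂ) (hus : ∀ b, star (u b) = -u b) (hu0 : ∀ b, (u b).trace = 0)

include hus hu0

omit [NeZero N] [DecidableEq (PBond P 0)] hus hu0 in
/-- `SU(N) ⊂ M_N(ℂ)` is second countable (private twin of `Literature.Barriers.QuantumFields.secondCountableTopology_su`, kept local). [folklore] -/
private theorem secondCountable_specialUnitaryGroup : SecondCountableTopology (Matrix.specialUnitaryGroup (Fin N) ℂ) := by
  haveI := secondCountableTopology_matrix (n := Fin N)
  exact Topology.IsEmbedding.subtypeVal.secondCountableTopology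

omit [DecidableEq (PBond P 0)] in
/-- The `SU(N)` data: second countability, the normalised-trace identity, and flows `k b t ∈ SU(N)` with `fundamentalRep (k b t) = exp(t u_b)`
(lit ✓ `mem_oneParamGenerators_specialUnitaryGroup` through ✓ `exists_oneParam_specialUnitaryGroup`). [cite: Chatterjee2019LargeN, §8] -/
theorem su_data :
    (∀ g : Matrix.specialUnitaryGroup (Fin N) ℂ, reTr g = (fundamentalRep (Fin N) g).trace.re / N) ∧
    ∃ k : PBond P 0 → ℝ → Matrix.specialUnitaryGroup (Fin N) ℂ,
      (∀ b s t, k b (s + t) = k b s * k b t) ∧ (∀ b t, fundamentalRep (Fin N) (k b t) = exp ((t : ℂ) • u b)) := by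
  refine ⟨fun g => ?_, ?_⟩
  · show UnitaryModel.nReTr (g : Matrix (Fin N) (Fin N) ℂ) = _
    simp [UnitaryModel.nReTr, Fintype.card_fin]
  · choose k hk hkX using fun b => exists_oneParam_specialUnitaryGroup (hus b) (hu0 b)
    exact ⟨k, hk, hkX⟩

/-- ★★★ **GROSS'S GAUSSIAN DOMINATION FOR `SU(N)` LATTICE YANG–MILLS ON BAŁABAN'S TORI** (`β > 0`, every real `s`, every torus, every U-independent
skew-Hermitian traceless bond field `u`): `∫ exp(s·X_u) dμ_β ≤ exp(K(u)·s²∕(2β))` with `X_u = actionDeriv (fundamentalRep (Fin N)) u = ∂_u A`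
(✓ `hasDerivAt_wilsonAction4_flow`) and `K(u) = hessianBound u`. [cite: GrossCMP1983, Thm 2.2] -/
theorem su_integral_exp_mul_actionDeriv_le {β : ℝ} (hβ : 0 < β) (s : ℝ) :
    ∫ U, Real.exp (s * actionDeriv (fundamentalRep (Fin N)) u U) ∂gibbsMeasure P β ≤ Real.exp (hessianBound u * s ^ 2 / (2 * β)) := by
  haveI := secondCountable_specialUnitaryGroup (N := N)
  obtain ⟨hre, k, hk, hkX⟩ := su_data (P := P) u hus hu0
  exact integral_exp_mul_actionDeriv_le (continuous_fundamentalRep (Fin N)) hre fundamentalRep_mem_unitaryGroup u hk hkX hβ s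

/-- ★ `∫ X_u dμ_β = 0` for `SU(N)`. [cite: Chatterjee2019LargeN, §8] -/
theorem su_integral_actionDeriv_eq_zero {β : ℝ} (hβ : 0 < β) :
    ∫ U, actionDeriv (fundamentalRep (Fin N)) u U ∂gibbsMeasure P β = 0 := by
  haveI := secondCountable_specialUnitaryGroup (N := N)
  obtain ⟨hre, k, hk, hkX⟩ := su_data (P := P) u hus hu0
  exact integral_actionDeriv_eq_zero (continuous_fundamentalRep (Fin N)) hre fundamentalRep_mem_unitaryGroup u hk hkX hβ

/-- ★★★ **THE VARIANCE AT THE FREE SCALE FOR `SU(N)`**: `∫ X_u² dμ_β ≤ K(u)∕β`. [cite: GrossCMP1983, Thm 2.2] -/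
theorem su_integral_actionDeriv_sq_le {β : ℝ} (hβ : 0 < β) :
    ∫ U, actionDeriv (fundamentalRep (Fin N)) u U ^ 2 ∂gibbsMeasure P β ≤ hessianBound u / β := by
  haveI := secondCountable_specialUnitaryGroup (N := N)
  obtain ⟨hre, k, hk, hkX⟩ := su_data (P := P) u hus hu0
  exact integral_actionDeriv_sq_le (continuous_fundamentalRep (Fin N)) hre fundamentalRep_mem_unitaryGroup u hk hkX hβ

/-- ★★ **THE UPPER TAIL FOR `SU(N)`**: `μ_β{r ≤ X_u} ≤ exp(−β r²∕(2K(u)))`. [cite: GrossCMP1983, Thm 2.2; BoucheronLugosiMassart2013, §2.2] -/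
theorem su_measureReal_actionDeriv_ge_le {β : ℝ} (hβ : 0 < β) (hKpos : 0 < hessianBound u) {r : ℝ} (hr : 0 ≤ r) :
    (gibbsMeasure (G := Matrix.specialUnitaryGroup (Fin N) ℂ) P β).real {U | r ≤ actionDeriv (fundamentalRep (Fin N)) u U} ≤
      Real.exp (-(β * r ^ 2 / (2 * hessianBound u))) := by
  haveI := secondCountable_specialUnitaryGroup (N := N)
  obtain ⟨hre, k, hk, hkX⟩ := su_data (P := P) u hus hu0
  exact measureReal_actionDeriv_ge_le (continuous_fundamentalRep (Fin N)) hre fundamentalRep_mem_unitaryGroup u hk hkX hβ hKpos hr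

end SpecialUnitary

section GibbsK

open Literature.MathematicalPhysics.QuantumFieldTheory.Balaban1983to89.T3ContinuumYM3Torus
open Literature.MathematicalPhysics.QuantumFieldTheory.Balaban1983to89.T3UnitScaleTilt

variable {N : ℕ} [NeZero N]

/-- ★★ **ON BAŁABAN'S `gibbsK`** (`SU(N)`, `γ > 0`, every family, every `K`; `gibbsK F ℰ γ K = gibbsMeasure (F.P K) β_K` by `rfl`, `β_K = (γ ε_K)⁻¹ > 0`): for every
U-independent skew-Hermitian traceless bond field `u` on the finest lattice `T^{(0)}` of the `K`-th torus,
`∫ X_u² d gibbsK ≤ K(u) ∕ β_K` and `∫ exp(s X_u) d gibbsK ≤ exp(K(u) s²∕(2β_K))` — the free-field size of every Schwinger–Dyson observable of `SU(N)` lattice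
Yang–Mills, uniformly in the volume.  (The LINE 28 hook: with `u` a frozen box test field the divergence defect (ii′) is absent; the sharp constant needs S_dom.)
[cite: GrossCMP1983, Thm 2.2; Balaban1985UV3, (1)-(3) p.256] -/
theorem gibbsK_actionDeriv_subgaussian (F : T3Family)
    (ℰ : LoopAverage (Matrix.specialUnitaryGroup (Fin N) ℂ)) {γ : ℝ} (hγ : 0 < γ) (K : ℕ) [DecidableEq (PBond (F.P K) 0)]
    (u : PBond (F.P K) 0 → Matrix (Fin N) (Fin N) ℂ) (hus : ∀ b, star (u b) = -u b) (hu0 : ∀ b, (u b).trace = 0) :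
    (∫ U, actionDeriv (fundamentalRep (Fin N)) u U ^ 2 ∂gibbsK F ℰ γ K ≤ hessianBound u / (F.scheme ℰ γ).β K) ∧
    ∀ s : ℝ, ∫ U, Real.exp (s * actionDeriv (fundamentalRep (Fin N)) u U) ∂gibbsK F ℰ γ K ≤
      Real.exp (hessianBound u * s ^ 2 / (2 * (F.scheme ℰ γ).β K)) := by
  have hβK : (F.scheme ℰ γ).β K = (γ * (F.P K).eps)⁻¹ := rfl
  have hβ : 0 < (F.scheme ℰ γ).β K := by
    rw [hβK]
    exact inv_pos.mpr (mul_pos hγ (F.P K).eps_pos)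
  exact ⟨su_integral_actionDeriv_sq_le u hus hu0 hβ, fun s => su_integral_exp_mul_actionDeriv_le u hus hu0 hβ s⟩

end GibbsK

end Summit.QuantumFields.YangMills.Theorems.UnitScaleGibbsActionDerivativeGaussianDomination

end
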